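import Literature.NumberTheory.EllipticCurves.Disegni2017.CyclotomicLineRankinSelberg
import Literature.NumberTheory.GaloisRepresentations.HeckeCharacterConductorExponent
import HarnessLib

/-!
# Disegni 2017, Theorem A on the CYCLOTOMIC LINE THROUGH A GENERAL FINITE-ORDER CHARACTER `χ`
# of an imaginary quadratic `K` (`p` SPLIT, ANY prime `p` — `p = 2` included): both printed
# branches of the interpolation factor `Z_w`, Definition 4 («not exceptional»), the interpolation
# predicate `ChiLineInterpolation`, and ONE named fact `thmA_chiLine`

Topic `Literature/NumberTheory/EllipticCurves`, cluster `Disegni2017` (namespace = path). EXTENDS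
`CyclotomicLineRankinSelberg.lean` (cell `bsd-addord`: Theorem A on the line through `𝟙_K`, and
Theorem B ÷ YZZ (1.1.3) at `𝟙_K`, for `E = V ⊗ ε` with the RAMIFIED unit character `α₀·ε_p`) — same
receptacle `IsLineFunction` / `HasLineValueAt`, same evaluation points `cycLinePoint ι θ`, same
`θ`-range, same complex currency `rankinSelbergEulerProductHecke` and `ι : ℚ̄_p ≅ ℂ`, same choice of
additive character — to the line through an ARBITRARY finite-order idelic Hecke character
`χ : HeckeCharacter K` (the Hsieh frame of `AnticyclotomicRankinSelbergPAdicLFunction.lean`), for an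
UNRAMIFIED unit character `α` (good ordinary or multiplicative reduction at `p`). Written by the typer
seat `bsd-print-cf2-ty2` (g49) of the cell `bsd-print-cf2` on the planner's SUMMON (U5a′) (HOME
`run/shared/lean/pub/bsd-print-cf2/`, `wake/SUMMON-bsd-print-cf2-ty2-20260830T154423Z.md`; companion
texts `bsd-print-cf2-plan/ENTRY-TICKET-disegni-thmB-g24.md`, `TYPING-BRIEF-disegni-thmAB-g24.md`) for
road (C) `disegni-pair-two` of the crux `PrintCf2.SplitBadTwoRankOneOfFacts` (stmt 20368): the pair
character `χ = χ₀·χ₂·ε_{d′}∘N` of that road has a genuine non-base-change finite-order component, so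
the cluster's line `baseChangeDirichlet K θ = θ∘N` does not reach it, and `χ` is RAMIFIED at the two
places above `p = 2`, so BOTH branches of `Z_w` and Definition 4 are needed. BSD is not proved by any
of this; the named fact is an unproved hypothesis `(h : thmA_chiLine)` for its consumers.

## The source (Disegni, Compos. Math. 153 (2017) 1987–2074 = arXiv:1510.02114v3; held text
## `paper:arxiv-1510.02114`, locators `pN Lk` = materialised page/line), verbatim

[p5 L6] «We fix from now on a rational prime `p`.» — NO parity/size restriction on `p` anywhere in
§1.1–§1.3 (the only printed `p ≠ 2` of the series is Thm. 6 of arXiv:2001.00045, p11 L14–16, NOT an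
input here). [p5 L8–12] **Definition 2** (= Def. 1.2.2): «`σ_v` is nearly ordinary for weight `2` with
unit character `α_v` if `σ_v` is an infinite-dimensional subrepresentation of the un-normalised
principal series `Ind(|·|_v α_v, β_v)` … Concretely, `σ_v` is then either an irreducible principal
series or special of the form `St(α_v)`.» [p5 L22–36] `Γ = E^×_{𝔸^∞}/\overline{E^× V^p}`,
`Γ_F = 𝔸^{∞,×}/\overline{F^× Ô_F^{p,×}}`, `𝒴′_ω(V^p)(A) = {χ′ : Γ → A^× : ω·χ′|_{Ô_F^{p,×}} = 1}`,
`𝒴_ω(V^p)(A) = {χ : ω·χ|_{𝔸^{∞,×}} = 1}`, `𝒴_F`; [p5 L49–57] the ind-schemes of locally constant (=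
finite-order) characters `𝒴′^{l.c.}`, `𝒴^{l.c.}`, `𝒴_F^{l.c.}`. [p6 L9–13] the torsor `Ψ_v` of additive
characters of level `0`. [p6 L31–59, p7 L1–6] **Theorem 1 (= Theorem A).** «There is a bounded
analytic function `L_{p,α}(σ_E) ∈ 𝒪_{𝒴′×Ψ_p}(𝒴′, ω_p⁻¹χ_{F,univ,p})^b` [corrected to
`(…, ω_p⁻¹α_p²|·|_p²χ_{F,univ,p})^b` in the Errata, JIMJ 22 (2023) §6, arXiv:1907.13040 p0021 L8–12],
uniquely determined by the following property: … for each `ℂ`-valued geometric point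
`(χ′, ψ_p) ∈ 𝒴′^{l.c.}_{M(α)} × Ψ_p(ℂ)` …
`L_{p,α}(σ_E)(χ′, ψ_p) = ∏_{v∣p} Z°_v(χ′_v, ψ_v) · π^{2[F:ℚ]}|D_F|^{1/2} L(1/2, σ_E^ι ⊗ χ′) /
(2L(1,η)L(1,σ^ι,ad))` in `ℂ`. The interpolation factor is explicitly
`Z°_v(χ′_v, ψ_v) := ζ_{F,v}(2)L(1,η_v)² / L(1/2, σ_{E,v} ⊗ χ′_v) · ∏_{w∣v} Z_w(χ′_w, ψ_v)` with
`Z_w(χ′_w, ψ_v) = α_v(ϖ_v)^{−v(D)} χ′_w(ϖ_w)^{−v(D)} (1 − α_v(ϖ_v)^{−f_w}χ′_w(ϖ_w)^{−1}) /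
(1 − α_v(ϖ_v)^{f_w} χ′_w(ϖ_w) q_{F,v}^{−f_w})` if `χ′_w·α_v∘q_w` is unramified, and
`= τ(χ′_w·α_v∘q, ψ_{E_w})` if `χ′_w·α_v∘q_w` is ramified. Here … `q_w` is the relative norm of
`E/F`, `f_w` is the inertia degree of `w∣v`, and `q_{F,v}` is the cardinality of the residue field at
`v`; finally, for any character `χ̃′_w` of `E_w^×` of conductor `𝔣`,
`τ(χ̃′_w, ψ_{E_w}) := ∫_{w(t) = −w(𝔣)} χ̃′_w(t) ψ_{E,w}(t) dt` with `dt` the restriction of the additive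
Haar measure on `E` giving `vol(𝒪_E, dt) = 1`, and `ψ_{E,w} = ψ_{F,v} ∘ Tr_{E_w/F_v}`.» [p7 L10–14]
«In fact, we only construct `L_{p,α}(σ_E)` as a bounded section of `𝒪(…)(D)`, where `D` is a divisor
on `𝒴′` supported away from `𝒴` …; see Theorem 3.7.1 together with Proposition 3.6.3 for the precise
statement. This is sufficient for our purposes and to determine `L_{p,α}(σ_E)` uniquely. One can then
deduce that it is possible to take `D = 0` by comparing … One such construction has been announced by
David Hansen.» — recorded, NOT typed away: the named fact below is Theorem A AS STATED AND CORRECTED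
(bounded on `𝒴′`), of which this paragraph qualifies the proof. [p7 L50] **Definition 4** (= Def.
1.3.3): «A locally constant character `χ_w` of `E_w^×` is said to be not exceptional if `Z_w(χ_w) ≠ 0`.
A character `χ ∈ 𝒴^{l.c.}_{M(α)}` is said to be not exceptional if for all `w∣p`, `χ_w` is not
exceptional.» [p9 L25–26] «… vanishes unless `χ_w·α_v∘q_w = 𝟙` on `E_w^×`, that is unless `χ_w` is
exceptional.»

## What is typed (`F = ℚ`, `E = K` imaginary quadratic, `p𝒪_K = 𝔭𝔭′` SPLIT, `σ = σ_f` of trivial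
## character — e.g. `σ_E` of an elliptic curve `E/ℚ` —, `α_p` UNRAMIFIED), and why each clause follows

SPECIALISATIONS (each only shrinks the printed generality; `-- TODO(general form)` below):
* (S1) `F = ℚ` (`[F:ℚ] = 1`, `|D_F| = 1`, `d = 1`), `E = K` imaginary quadratic (`IsImaginaryQuadratic`,
  Galois over `ℚ`), `p` SPLIT: two places `𝔭 ≠ 𝔭′` above `p` — explicit parameters, as the Hsieh
  file's `𝔭` — with `E_w = F_v = ℚ_p`, `f_w = 1`, `v(D) = 0`, `q_w = id`, `q_{F,v} = p`, `η_p = 𝟙`,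
  hence `ζ_{ℚ_p}(2)L(1,η_p)² = u := splitLocalConstant p` (cluster (c3)) and `ϖ_w = ϖ_v = p`
  (`natUnitAt w p`).
* (S2) `σ = σ_f` for a NEWFORM `f ∈ S₂(Γ₀(N))` (`IsNewform0 f`: trivial character, `ω = 𝟙`; the
  complex `f` is Disegni's `σ^ι` and the prime `𝔭` of `M = ℚ(a_n)` is the one under `ι⁻¹`; for an
  elliptic curve `E/ℚ`: `f` THE newform of `E`, `N = N_E`, `IsNewformOf W f`, `M = ℚ`), with `σ_p`
  nearly `𝔭`-ordinary with an UNRAMIFIED unit character `α_p`, `α_p(p) = α`: typed as `p² ∤ N` and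
  «`a ∈ ℂ` is a root of the Hecke polynomial `X² − a_p(f)X + p·𝟙_{p∤N}` with `‖ι⁻¹(a)‖_p = 1`»
  (`a = ι(α)`). For `ω = 𝟙` these are EXACTLY the two printed shapes of Def. 1.2.2 with unramified
  `α_v`: `p ∤ N`, `σ_p` an unramified principal series, ORDINARY at `𝔭` (`α` the unit root; for
  `E/ℚ`: `IsOrdinaryAt`, `α = unitRoot W p`, `heckePolynomial_clause_of_unitRoot`), or `p ∥ N`,
  `σ_p = St(α_p)` with `α = a_p(f) = ±1` (for `E/ℚ`: multiplicative reduction). The cluster's RAMIFIED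
  `α₀·ε_p` (for `E = V ⊗ ε` additive at `p`) is NOT a case of this file; by the frame change
  `σ_{E,K} ⊗ θ_K = σ_{V,K} ⊗ (εθ)_K` (cluster sheet c10) its line is this file's line through
  `χ = ε∘N` for the ORDINARY curve `V` (odd `p`).
* (S3) `χ` a finite-order idelic Hecke character of `K` (`HeckeCharacter K`, `IsFiniteOrder`) with
  `χ|_{Ẑ^{(p),×}} = 1`, typed as «`χ(x) = 1` for every idele `x` of `ℚ` which is a local unit at a
  finite place `v ∤ p`» (`AdeleRing.ideleBaseChange ℚ K`, `localUnits`): VERBATIM `ω·χ′|_{Ô_F^{p,×}} = 1`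
  for `ω = 𝟙`, i.e. `χ ∈ 𝒴′^{l.c.}` [p5 L33, L52] (for the tame level `V^p := ker χ ∩ Ô_E^{p,×}`, an
  open compact subgroup on which every point `χ·θ_K` of the line is trivial, `θ_K` being unramified
  outside `p`). Ring class characters (`χ|_{𝔸_ℚ^×} = 1`, i.e. `χ ∈ 𝒴^{l.c.}`) qualify; so does every
  `θ_K`.
* (S4) THE LINE through `χ`: the points `χ′ = χ · θ_K`, `θ_K = baseChangeDirichlet K θ = θ∘N_{K/ℚ}`,
  `θ` a Dirichlet character mod `p^{m+1}`, EVEN, of `p`-POWER ORDER, PRIMITIVE unless `m = 0` — the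
  cluster's range (c2) verbatim: the finite-order characters of `Γ_ℚ = ℤ_p^×/{±1}` lying over its
  component through `𝟙` (`1 + pℤ_p` for odd `p`), each once, together with `θ = 𝟙` at level `p`.
  AT `p = 2`: `Γ_ℚ = ℤ₂^×/{±1} ≅ 1 + 4ℤ₂ ≅ ℤ₂` is torsion-free, `(ℤ/2^{m+1})^×` is a `2`-group, so the
  range is ALL even Dirichlet characters of `2`-power conductor (the trivial one at level `2`, the
  primitive even ones at levels `2^{m+1} ≥ 8`; level `4` has no even primitive character) — exactly
  the finite-order points of `𝒴_F` at `2`, each once, accumulating at the base point.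
* (S5) TREE CURRENCY FOR THE COMPLEX VALUES (the ONE binder that is not Disegni's): the clauses
  quantify over every ENTIRE CONTINUATION `Λ` of `rankinSelbergEulerProductHecke f (χθ_K) s` from
  `re s > 2` (cluster (c1): Disegni's `L(s, σ_{E,K} ⊗ χ′)` in unitary normalisation is the tree's Euler
  product at `s + 1/2`, so `L(1/2, σ_{E,K} ⊗ χ′) = Λ(1)`). That Euler product puts the factor `1` at
  every place where `χ′` is RAMIFIED (`heckeValueExtZero = 0`) and the `a_ℓ(f)`-factor elsewhere; this
  IS the automorphic Euler factor of `σ_{E,K_w} ⊗ χ′_w` when `σ_ℓ` is an unramified principal series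
  (`ℓ ∤ N`) or Steinberg with unramified character (`ℓ ∥ N`) — a ramified twist kills both local
  factors —, and at every place where `χ′_w` is unramified (standard), but NOT in general when `χ′_w`
  and `σ_ℓ` are both ramified with `ℓ² ∣ N` (the twist may lower the conductor: then the automorphic
  factor is a non-trivial, `θ`-DEPENDENT polynomial in `θ_K(ϖ_w)N(w)^{-s}` that the tree's product
  drops, and the typed `∃ G` could fail). Hence the binder «`χ` is unramified at every place above a
  prime `ℓ` with `ℓ² ∣ N_E`» (additive reduction), under which the tree's Euler product is Disegni's
  `L(s − 1/2, σ_{E,K} ⊗ χθ_K)` AT EVERY POINT of the line (`θ_K` is ramified only above `p`, where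
  `p² ∤ N_E` by (S2)). It allows `χ` ramified above `p` (the road-(C) case: `A` good ordinary at `2`,
  `χ_w` of conductor `4` or `8`) and `(cond χ, N_E) > 1` at multiplicative primes; it is NOT the
  Heegner-type coprimality `(cond χ, N) = 1`.
EVALUATIONS (a printed symbol replaced by its value on the typed range):
* (E1) `Z_w(χ′_w, ψ⁰)` for `w ∈ {𝔭, 𝔭′}`, `a := ι(α) ∈ ℂ` (the parameter `a` of the defs), `c := χ′_w(p)`
  (`valueAtP`): since `α_p` is unramified, «`χ′_w·α_p∘q_w` unramified» iff `χ′_w` unramified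
  (`IsUnramifiedAt`), and then `Z_w = (1 − a⁻¹c⁻¹)/(1 − a c p⁻¹)` (`χ′_w(ϖ_w)` is independent of the
  uniformiser, `valueAtP_eq_valueAtUniformizer`); otherwise `χ̃ := χ′_w·α_p` has conductor `p^n`,
  `n = f(χ′_w) ≥ 1` (`HeckeCharacter.conductorExponentAt`), `{w(t) = −n} = p^{−n}ℤ_p^× = ⊔_{k}
  (p^{−n}k + ℤ_p)` over `0 < k < p^n`, `p ∤ k` (cosets of `dt`-volume `1`, on which the integrand is
  constant), `χ̃(p^{−n}k) = χ̃(p)^{−n}χ′_w(k) = (c a)^{−n} χ′_w(k)` (`α_p` trivial on units, `q = id`),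
  `ψ_{E,w}(p^{−n}k) = ψ⁰(k/p^n) = e^{2πik/p^n}` — so `Z_w = (c a)^{−n} · Σ_{k} χ′_w(k) e(k/p^n)`
  (`localGaussSum`, `localValueNat`; `interpolationFactorZw`, two branches by `if … IsUnramifiedAt`).
  CHOICE recorded (as cluster (c4)): `ψ_p = ψ⁰`, `ψ⁰(x) = e^{2πi{x}_p}` = Mathlib `ZMod.stdAddChar` on
  `p^{−n}ℤ_p/ℤ_p = ℤ/p^n`, a character of level `0` (trivial on `ℤ_p`, not on `p⁻¹ℤ_p`); Theorem A
  holds for every `ψ_p ∈ Ψ_p`, the other choices `a.ψ⁰` multiply `Z_w` by `χ̃(a)⁻¹` and the function by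
  the corresponding section automorphism — immaterial to the `∃ G` statement and to ratio statements.
* (E2) `L(1/2, σ_{E,p} ⊗ χ′_p) = L_𝔭 · L_{𝔭′}`, `L_w = [(1 − a c p⁻¹)(1 − (e_p/a) c p⁻¹)]⁻¹` for `χ′_w`
  unramified (`e_p = p` if `p ∤ N`, `0` if `p ∣ N`: the second Satake parameter `β = e_p/α`, the
  convention of the tree's `rankinSelbergLocalFactorInvHecke` at `s = 1`) and `L_w = 1` for `χ′_w`
  ramified (`localEulerFactor`). So `∏_{v∣p} Z°_v(χ′_v) = u · (Z_𝔭/L_𝔭)(Z_{𝔭′}/L_{𝔭′}) =: zCirc`.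
* (E3) THE VALUE IN `ℂ_p`: `ι⁻¹(zCirc · Car · Λ(1))` (`chiLineValue`), `Car` the archimedean constant
  `π²/(2L(1,η)L(1,σ,ad)) > 0` carried as a parameter INDEPENDENT OF `χ` (cluster (c8)); unlike the
  cluster's `cycLineValue` the unit root enters READ IN `ℂ` (`a = ι(α)`; the unramified branch
  `1 − a⁻¹c⁻¹` is not multiplicative in `α`), which is the printed reading: the embedding
  `ι : M(α) → ℂ` «induced by `χ′`» is the restriction of our `ι : ℚ̄_p ≅ ℂ` to `M(α) ⊂ ℚ̄_p`, the
  typed points being those lying over it.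
* (E4) THE POINT of `χθ_K` on the line and the receptacle: `cycLinePoint ι θ = ι⁻¹(θ(γ))⁻¹ − 1`,
  `γ = cyclotomicGenerator p` (`= 1 + p`, resp. `5` at `p = 2`, a topological generator of
  `1 + p^{e₀}ℤ_p ≅ Γ_ℚ^{tors-free}`), and `G ∈ ℂ_p⟦T⟧` bounded with coefficients in a finite extension
  of `ℚ_p` (`IsLineFunction`, Lemma 10.2.1–10.2.2) — VERBATIM the cluster's (c5) and receptacle, so a
  consumer holding both files reads the `𝟙_K`-line and the `χ`-line in one coordinate. `G` is the
  restriction of `L_{p,α}(σ_{E})(·, ι⁻¹ψ⁰)` to the disc `{χ · χ_F∘N}` ≅ (component of) `𝒴_F`.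
NOT typed, NOT asserted: the identity `Car = π²/(2L(1,η_K)L(1,σ_E,ad))` (no tree object for
`L(1,σ,ad)`); uniqueness of `G` (it follows from the accumulation of the typed points, consumer-side,
as in the cluster: `MemIwasawaRat`-type uniqueness); anything at `p` inert or ramified in `K`.

## Definition 4 in the two branches (API of this file)

`IsNotExceptionalAt ι α χ w := interpolationFactorZw ι α χ w ≠ 0` (Def. 1.3.3 verbatim, per place).
PROVED: `isNotExceptionalAt_iff_of_isUnramifiedAt` — for `χ_w` unramified (and `a c ≠ p`, automatic
for the unit root of an elliptic curve: `|a c| = √p`), not exceptional iff `a·c ≠ 1`, i.e. iff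
`χ_w·α_p∘q_w ≠ 𝟙` [p9 L25–26]; `isNotExceptionalAt_iff_of_not_isUnramifiedAt` — for `χ_w` RAMIFIED,
not exceptional iff `localGaussSum χ w (f(χ_w)) ≠ 0`, and a Gauss sum of a character of conductor
EXACTLY `p^n` is non-zero (Lemma A.1.1, PDF p. 70; `|τ|² = p^{n}` up to normalisation): the discharge
«`χ_w` ramified ⇒ not exceptional» of the road-(C) entry ticket §2 is thus ONE bridge lemma
(`localGaussSum χ w n = gaussSum ξ stdAddChar` for the primitive Dirichlet character `ξ` mod `p^n`
induced by `χ_w` on `(𝒪_w/p^n)^× = (ℤ/p^n)^×`) away from the tree's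
`Literature.NumberTheory.LFunctions.gaussSum_mul_gaussSum_inv_eq_natCast` /
`…PSPrimePowerGauss.gaussSum_ne_zero_of_isPrimitive` — a prover task, not restated here.

## Non-vacuity and consumer pattern

`thmA_chiLine` asserts the EXISTENCE of a bounded line function with prescribed values at infinitely
many points accumulating at `T = 0` — the `p`-adic continuity of `θ ↦ Z°_p((χθ_K)_p)·L(1/2, σ_{E,K} ⊗
χθ_K)/(period)`, genuine content (unlike an `∃` over an abstract height datum; cf. the cluster's
§«Vacuity», which concerns Theorem B only). `Car` is quantified BEFORE `χ` (one constant for all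
lines, as printed), so a consumer may compare the lines through `χ` and through `χ⁻¹`, or through `χ`
and `𝟙_K`. The companion file `ChiLineGrossZagier.lean` (U5b′) puts Theorem B ÷ YZZ (1.1.3) at the
base point `χ` of this line in the cluster's ratio shape.

## What is NOT here

No height, no CM point, no Theorem B (companion file); no anticyclotomic variable; no `p` inert or
ramified in `K`; no ramified unit character; no `GL₂`-type `A` with `M ≠ ℚ`; nothing ASSERTED except
`thmA_chiLine`. `-- TODO(general form): Theorem A for totally real F, any CM extension E/F (the
-- inert/ramified branches of Z_w with f_w, v(D)), ramified unit characters α_v (defect-e twists),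
-- M-rational σ of GL₂-type, and characters χ′ jointly ramified with an additive prime of σ (needs the
-- automorphic local factors L(s, σ_{E,w} ⊗ χ′_w) that rankinSelbergEulerProductHecke drops).`

## References

* [Disegni2017] D. Disegni, *The `p`-adic Gross–Zagier formula on Shimura curves*, Compos. Math. 153
  (2017) 1987–2074 = arXiv:1510.02114v3: Def. 1.2.2 (p5 L8–18), §1.2.1 `𝒴′, 𝒴, 𝒴_F`, `𝒴^{l.c.}`
  (p5 L20–57), §1.2.2 `Ψ_v` (p6 L7–29), Theorem A with `Z°_v`, `Z_w`, `τ` (p6 L31–59, p7 L1–14),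
  Def. 1.3.3 (p7 L50), §1.4.1 (p9 L25–26), Lemma 10.2.1/10.2.2 (PDF p. 68), Lemma A.1.1 (PDF p. 70).
* [Disegni2023ShimuraII] D. Disegni, *… II: nonsplit primes*, J. Inst. Math. Jussieu 22 (2023) =
  arXiv:1907.13040, §6 «Errata to [1]» (materialised p0021 L1–18): Theorem A (the sheaf), Theorem B
  (constant `c_E`), the footnote on `d_F` vs the derivative along `χ_F ↦ χ·χ_F∘q`.
* Cluster: `CyclotomicLineRankinSelberg.lean` (conventions (c1)–(c8), receptacle, `cycLinePoint`,
  `splitLocalConstant`, `baseChangeDirichlet`); `AnticyclotomicRankinSelbergPAdicLFunction.lean`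
  (Hsieh frame: `HeckeCharacter K`, `𝔭` as a parameter, `ι`).
* Cell: `run/shared/lean/pub/bsd-print-cf2/bsd-print-cf2-plan/ENTRY-TICKET-disegni-thmB-g24.md` §1–§2,
  `TYPING-BRIEF-disegni-thmAB-g24.md` §2 (U5a) and ADDENDUM, `wake/SUMMON-bsd-print-cf2-ty2-…154423Z.md`.
-/

noncomputable section

open scoped MatrixGroups ModularForm NumberField
open CongruenceSubgroup NumberField IsDedekindDomain WeierstrassCurve
open Literature.NumberTheory.GaloisRepresentations
open Literature.NumberTheory.EllipticCurves.ModularForms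
open Literature.NumberTheory.Automorphic

namespace Literature.NumberTheory.EllipticCurves.Disegni2017

/-! ### §1 Local models at a place `w ∣ p` of degree one (`K_w = ℚ_p`) -/

section LocalModel

variable (p : ℕ) [Fact p.Prime] {K : Type} [Field K] [NumberField K]

/-- **The unit `k ∈ K_w^×` attached to a non-zero natural number `k`** (the image of `k ∈ ℚ ⊂ K`
in the completion `K_w`). For `k = p` at a place `w ∣ p` of degree one this is Disegni's uniformiser
`ϖ_w = ϖ_v = p` of `E_w = ℚ_p`; for `k` prime to `p` it is a unit of `𝒪_w`, a representative of the
class `k mod p^n ∈ (ℤ/p^n)^× = (𝒪_{E_w}/𝔣)^×`. [cite: Disegni2017, Theorem A, Z_w and τ (arXiv v3 PDF p. 6 L54–59, p. 7 L1–6)] -/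
def natUnitAt (w : HeightOneSpectrum (𝓞 K)) (k : ℕ) (hk : k ≠ 0) : (w.adicCompletion K)ˣ :=
  Units.map (algebraMap K (w.adicCompletion K) : K →+* w.adicCompletion K).toMonoidHom
    (Units.mk0 ((k : ℕ) : K) (Nat.cast_ne_zero.mpr hk))

/-- **`χ_w(p)`**: the value of the local component `χ_w` of the idelic Hecke character `χ` at the
uniformiser `p ∈ K_w` (Disegni's `χ'_w(ϖ_w)` at a split place, `ϖ_w = p`; for `χ` unramified at `w`
it is the tree's `χ.valueAtUniformizer w` whenever `w ∣ p` is unramified, by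
`HeckeCharacter.localComponent_eq_valueAtUniformizer`).
[cite: Disegni2017, Theorem A, the factor Z_w (arXiv v3 PDF p. 6 L54–59)] -/
def valueAtP (χ : HeckeCharacter K) (w : HeightOneSpectrum (𝓞 K)) : ℂ :=
  (χ.localComponent w (natUnitAt w p (Fact.out : p.Prime).ne_zero) : ℂ)

/-- **`χ_w(k)` for a natural number `k`, extended by zero**: the value of the local component `χ_w`
at the unit `k ∈ K_w^×` (`0` at `k = 0`). For `w ∣ p` and `k` prime to `p` this is Disegni's
`χ̃'_w(t)` at the representative `t = k` of a class of `(𝒪_{E_w}/𝔣)^×` (the unramified unit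
character `α_p` being trivial on units, `χ̃'_w = χ'_w · α_p∘q_w` agrees with `χ'_w` there).
[cite: Disegni2017, Theorem A, τ(χ̃'_w, ψ_{E_w}) (arXiv v3 PDF p. 7 L2–6)] -/
def localValueNat (χ : HeckeCharacter K) (w : HeightOneSpectrum (𝓞 K)) (k : ℕ) : ℂ :=
  if hk : k = 0 then 0 else (χ.localComponent w (natUnitAt w k hk) : ℂ)

/-- **The local Gauss sum of `χ_w` at level `p^n`** (`w ∣ p` of degree one, `E_w = ℚ_p`):
`Σ_{0 < k < p^n, p ∤ k} χ_w(k) · e(k/p^n)` with the standard additive character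
`e(x) = exp(2πi x)` of `ℤ/p^n` (Mathlib `ZMod.stdAddChar`) — i.e. the level-`0` character
`ψ⁰(x) = e^{2πi{x}_p}` of `ℚ_p` on `p^{-n}ℤ_p/ℤ_p`, the CHOICE `ψ_p = ψ⁰ ∈ Ψ_p` recorded in
`CyclotomicLineRankinSelberg.lean` (c4). For `χ̃ = χ_w · α_p` of conductor exactly `𝔣 = p^n`
(`α_p` unramified), Disegni's `τ(χ̃, ψ_{E_w}) = ∫_{w(t) = −w(𝔣)} χ̃(t) ψ_{E,w}(t) dt` (`dt` with
`vol(𝒪_{E_w}) = 1`, `ψ_{E,w} = ψ_p ∘ Tr = ψ_p`) is the sum over the cosets `p^{-n}k + ℤ_p`,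
`k ∈ (ℤ/p^n)^×` (each of volume `1`), of `χ̃(p^{-n}k) ψ⁰(k/p^n)`, i.e.
`τ = χ̃(p)^{-n} · localGaussSum χ w n = (χ_w(p)·α)^{-n} · localGaussSum χ w n`.
[cite: Disegni2017, Theorem A, τ(χ̃'_w, ψ_{E_w}) (arXiv v3 PDF p. 7 L2–6)] -/
def localGaussSum (χ : HeckeCharacter K) (w : HeightOneSpectrum (𝓞 K)) (n : ℕ) : ℂ :=
  haveI : NeZero (p ^ n) := ⟨pow_ne_zero n (Fact.out : p.Prime).ne_zero⟩
  ∑ k ∈ Finset.range (p ^ n),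
    (if p ∣ k then 0 else localValueNat χ w k) * ZMod.stdAddChar (N := p ^ n) (k : ZMod (p ^ n))

variable {p}

/-- Unfolding `valueAtP`. [cite: Disegni2017, Theorem A (arXiv v3 PDF p. 6 L54–59)] -/
theorem valueAtP_def (χ : HeckeCharacter K) (w : HeightOneSpectrum (𝓞 K)) :
    valueAtP p χ w = (χ.localComponent w (natUnitAt w p (Fact.out : p.Prime).ne_zero) : ℂ) := rfl

/-- `χ_w(p)` is `χ_w` at the natural number `p`. [cite: Disegni2017, Theorem A (arXiv v3 PDF p. 6 L54–59)] -/
theorem localValueNat_prime (χ : HeckeCharacter K) (w : HeightOneSpectrum (𝓞 K)) :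
    localValueNat χ w p = valueAtP p χ w := by
  rw [localValueNat, dif_neg (Fact.out : p.Prime).ne_zero, valueAtP]

/-- `χ_w(p) ≠ 0` (a value of a character). [cite: Disegni2017, Theorem A (arXiv v3 PDF p. 6 L54–59)] -/
theorem valueAtP_ne_zero (χ : HeckeCharacter K) (w : HeightOneSpectrum (𝓞 K)) :
    valueAtP p χ w ≠ 0 :=
  Units.ne_zero _

/-- `(χ₁χ₂)_w(p) = (χ₁)_w(p) · (χ₂)_w(p)`. [cite: Disegni2017, Theorem A (arXiv v3 PDF p. 6 L54–59)] -/
theorem valueAtP_mul (χ₁ χ₂ : HeckeCharacter K) (w : HeightOneSpectrum (𝓞 K)) :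
    valueAtP p (χ₁ * χ₂) w = valueAtP p χ₁ w * valueAtP p χ₂ w := by
  simp only [valueAtP, HeckeCharacter.localComponent_apply]
  rfl

/-- The trivial character has `𝟙_w(p) = 1`. [cite: Disegni2017, Def. 1.3.3 (arXiv v3 PDF p. 7 L50)] -/
theorem valueAtP_one (w : HeightOneSpectrum (𝓞 K)) : valueAtP p (1 : HeckeCharacter K) w = 1 := by
  simp only [valueAtP, HeckeCharacter.localComponent_apply, HeckeCharacter.one_apply, Units.val_one]

/-- If `χ` is unramified at `w` and `p` has valuation one at `w` (`w ∣ p` unramified, e.g. `p` split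
in `K`), then `χ_w(p)` is the tree's `χ.valueAtUniformizer w` (independence of the uniformiser).
[cite: Disegni2017, Theorem A (arXiv v3 PDF p. 6 L54–59)] -/
theorem valueAtP_eq_valueAtUniformizer {χ : HeckeCharacter K} {w : HeightOneSpectrum (𝓞 K)}
    (h : χ.IsUnramifiedAt w)
    (hp : Valued.v ((natUnitAt w p (Fact.out : p.Prime).ne_zero : (w.adicCompletion K)ˣ) :
      w.adicCompletion K) = WithZero.exp (-1 : ℤ)) :
    valueAtP p χ w = χ.valueAtUniformizer w :=
  HeckeCharacter.localComponent_eq_valueAtUniformizer h hp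

end LocalModel

/-! ### §2 Disegni's interpolation factor `Z_w` (both branches), the local Euler factor, `Z°_p`,
and Definition 4 («not exceptional») — at a split prime, for an UNRAMIFIED unit character `α` -/

section Factors

variable {p : ℕ} [Fact p.Prime] {K : Type} [Field K] [NumberField K]

open scoped Classical in
/-- **Disegni's interpolation factor `Z_w(χ_w, ψ_p)` at a place `w ∣ p` of degree one, for the
unramified unit character `α_p` (`α_p(p) = α`), BOTH BRANCHES as printed** (`E_w = F_v = ℚ_p`:
`f_w = 1`, `v(D) = 0`, `q_w = id`, `q_{F,v} = p`, `ϖ_w = ϖ_v = p`; `a := ι(α) ∈ ℂ` the unit-root datum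
READ IN `ℂ` — the parameter of this file —, `c := χ_w(p)`):
* if `χ_w · α_p∘q_w` is UNRAMIFIED, i.e. (α_p unramified) `χ_w` unramified:
  `Z_w = (1 − α_v(ϖ_v)^{-1} χ_w(ϖ_w)^{-1}) / (1 − α_v(ϖ_v) χ_w(ϖ_w) q_{F,v}^{-1}) = (1 − a⁻¹c⁻¹)/(1 − a c p⁻¹)`;
* if it is RAMIFIED, of conductor `p^n`, `n = f(χ_w) ≥ 1` (`conductorExponentAt`):
  `Z_w = τ(χ_w·α_p, ψ_{E_w}) = (c·a)^{-n} · Σ_{k ∈ (ℤ/p^n)^×} χ_w(k) e(k/p^n)` (`localGaussSum χ w n`;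
  `ψ_p = ψ⁰` the standard level-`0` character, the cluster's recorded choice).
A complex number. [cite: Disegni2017, Theorem A, Z_w and τ (arXiv v3 PDF p. 6 L54–59, p. 7 L1–6)] -/
def interpolationFactorZw (a : ℂ) (χ : HeckeCharacter K) (w : HeightOneSpectrum (𝓞 K)) : ℂ :=
  if χ.IsUnramifiedAt w then
    (1 - a⁻¹ * (valueAtP p χ w)⁻¹) / (1 - a * valueAtP p χ w * ((p : ℂ))⁻¹)
  else
    ((valueAtP p χ w * a)⁻¹) ^ (χ.conductorExponentAt w) *
      localGaussSum p χ w (χ.conductorExponentAt w)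

/-- **Definition 4 (Disegni 2017, §1.3.1): `χ_w` is NOT EXCEPTIONAL** iff `Z_w(χ_w) ≠ 0`; «a
character `χ ∈ 𝒴^{l.c.}_{M(α)}` is said to be not exceptional if for all `w ∣ p`, `χ_w` is not
exceptional» (the global condition is the conjunction over the places above `p`, stated by the
consumer for its two places). Equivalently (PDF p. 9 L25–26): `χ_w · α_v∘q_w ≠ 𝟙` on `E_w^×` — in the
unramified branch `Z_w = 0 ⟺ a·c = 1` (`isNotExceptionalAt_iff_of_isUnramifiedAt`); in the ramified
branch `Z_w` is `(ca)^{-n}` times a Gauss sum of a character of conductor exactly `p^n`, which is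
non-zero (Lemma A.1.1; tree: `Literature.NumberTheory.LFunctions.gaussSum_mul_gaussSum_inv_eq_natCast`,
`…PSPrimePowerGauss.gaussSum_ne_zero_of_isPrimitive` for the Dirichlet-character form — the bridge
`localGaussSum χ w n = gaussSum ξ stdAddChar` for the primitive Dirichlet character `ξ` mod `p^n`
induced by `χ_w` on `(𝒪_w/p^n)^× = (ℤ/p^n)^×` is the consumer's discharge lemma).
[cite: Disegni2017, Def. 1.3.3 = «Definition 4» (arXiv v3 PDF p. 7 L50) and §1.4.1 (PDF p. 9 L25–26)] -/
def IsNotExceptionalAt (a : ℂ) (χ : HeckeCharacter K) (w : HeightOneSpectrum (𝓞 K)) : Prop :=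
  interpolationFactorZw (p := p) a χ w ≠ 0

open scoped Classical in
/-- **The local Euler factor `L(1/2, σ_{E,w} ⊗ χ_w)` at a place `w ∣ p` of degree one** for `σ_p`
nearly ordinary with UNRAMIFIED unit character (`a = ι(α)`, the other parameter `β = e_p/α` with
`e_p = p` at a good ordinary `p ∤ N` and `e_p = 0` at a multiplicative `p ∣ N` — the convention of
the tree's `rankinSelbergLocalFactorInvHecke`, unitary normalisation, centre `1/2` = the tree's
`s = 1`): `[(1 − a c p⁻¹)(1 − (e_p/a) c p⁻¹)]⁻¹` if `χ_w` is unramified (`c = χ_w(p)`), and `1` if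
`χ_w` is ramified (both characters of the principal series / the special representation become
ramified). [cite: Disegni2017, Theorem A, Z°_v (arXiv v3 PDF p. 6 L48–50); Def. 1.2.2 (PDF p. 5)] -/
def localEulerFactor (a : ℂ) (N : ℕ) (χ : HeckeCharacter K) (w : HeightOneSpectrum (𝓞 K)) : ℂ :=
  if χ.IsUnramifiedAt w then
    ((1 - a * valueAtP p χ w * ((p : ℂ))⁻¹) *
      (1 - (if p ∣ N then (0 : ℂ) else (p : ℂ)) * a⁻¹ * valueAtP p χ w * ((p : ℂ))⁻¹))⁻¹
  else 1

/-- **`Z°_p(χ_p) = ζ_{ℚ_p}(2)L(1,η_p)² / L(1/2, σ_{E,p} ⊗ χ_p) · ∏_{w∣p} Z_w(χ_w)`** at a prime `p`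
SPLIT in `K`, `p𝒪_K = 𝔭𝔭′` (`η_p = 𝟙`, so the first quotient is `u = splitLocalConstant p`;
`L(1/2, σ_{E,p} ⊗ χ_p) = L_𝔭 · L_{𝔭′}`): `u · (Z_𝔭/L_𝔭) · (Z_{𝔭′}/L_{𝔭′})`, a complex number
(`a = ι(α)` the unit root read in `ℂ`). At `χ = 𝟙_K` for `E = V ⊗ ε` this is NOT the cluster's
`zCircOne` (that one is the ramified-`α` frame); in the `(V, ε_K)` frame of the same function it is
this factor at `χ = ε_K`. [cite: Disegni2017, Theorem A, Z°_v (arXiv v3 PDF p. 6 L46–50)] -/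
def zCirc (a : ℂ) (N : ℕ) (χ : HeckeCharacter K) (𝔭 𝔭' : HeightOneSpectrum (𝓞 K)) : ℂ :=
  (splitLocalConstant p : ℂ) *
    (interpolationFactorZw (p := p) a χ 𝔭 / localEulerFactor (p := p) a N χ 𝔭) *
      (interpolationFactorZw (p := p) a χ 𝔭' / localEulerFactor (p := p) a N χ 𝔭')

/-! #### API -/

/-- Unfolding `IsNotExceptionalAt`. [cite: Disegni2017, Def. 1.3.3 (arXiv v3 PDF p. 7 L50)] -/
theorem isNotExceptionalAt_iff (a : ℂ) (χ : HeckeCharacter K) (w : HeightOneSpectrum (𝓞 K)) :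
    IsNotExceptionalAt (p := p) a χ w ↔ interpolationFactorZw (p := p) a χ w ≠ 0 := Iff.rfl

/-- The unramified branch of `Z_w`. [cite: Disegni2017, Theorem A, Z_w (arXiv v3 PDF p. 6 L57)] -/
theorem interpolationFactorZw_of_isUnramifiedAt {a : ℂ} {χ : HeckeCharacter K}
    {w : HeightOneSpectrum (𝓞 K)} (h : χ.IsUnramifiedAt w) :
    interpolationFactorZw (p := p) a χ w =
      (1 - a⁻¹ * (valueAtP p χ w)⁻¹) / (1 - a * valueAtP p χ w * ((p : ℂ))⁻¹) := by
  rw [interpolationFactorZw, if_pos h]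

/-- The ramified branch of `Z_w` (the Gauss-sum branch). [cite: Disegni2017, Theorem A, Z_w and τ (arXiv v3 PDF p. 6 L58, p. 7 L1–6)] -/
theorem interpolationFactorZw_of_not_isUnramifiedAt {a : ℂ} {χ : HeckeCharacter K}
    {w : HeightOneSpectrum (𝓞 K)} (h : ¬ χ.IsUnramifiedAt w) :
    interpolationFactorZw (p := p) a χ w =
      ((valueAtP p χ w * a)⁻¹) ^ (χ.conductorExponentAt w) *
        localGaussSum p χ w (χ.conductorExponentAt w) := by
  rw [interpolationFactorZw, if_neg h]

/-- The ramified branch of the local Euler factor is `1`. [cite: Disegni2017, Theorem A, Z°_v (arXiv v3 PDF p. 6 L48–50)] -/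
theorem localEulerFactor_of_not_isUnramifiedAt {a : ℂ} {N : ℕ} {χ : HeckeCharacter K}
    {w : HeightOneSpectrum (𝓞 K)} (h : ¬ χ.IsUnramifiedAt w) :
    localEulerFactor (p := p) a N χ w = 1 := by
  rw [localEulerFactor, if_neg h]

/-- **Unramified branch of Definition 4**: if `χ_w` is unramified and the denominator
`1 − a c p⁻¹` is non-zero (automatic in the theorem's use: `|a c p⁻¹| = p^{-1/2}` for the unit
root of an elliptic curve read in `ℂ`), then `χ_w` is not exceptional iff `a · c ≠ 1`, i.e. iff
`χ_w · α_p∘q_w ≠ 𝟙` on `ℚ_p^×`. [cite: Disegni2017, Def. 1.3.3 (arXiv v3 PDF p. 7 L50) and §1.4.1 (PDF p. 9 L25–26)] -/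
theorem isNotExceptionalAt_iff_of_isUnramifiedAt {a : ℂ} {χ : HeckeCharacter K}
    {w : HeightOneSpectrum (𝓞 K)} (h : χ.IsUnramifiedAt w) (hden : a * valueAtP p χ w ≠ p) :
    IsNotExceptionalAt (p := p) a χ w ↔ a * valueAtP p χ w ≠ 1 := by
  have hc : valueAtP p χ w ≠ 0 := valueAtP_ne_zero χ w
  have hp0 : (p : ℂ) ≠ 0 := Nat.cast_ne_zero.mpr (Fact.out : p.Prime).ne_zero
  have hden' : 1 - a * valueAtP p χ w * ((p : ℂ))⁻¹ ≠ 0 := by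
    intro h0
    apply hden
    field_simp at h0
    linear_combination -h0
  rw [isNotExceptionalAt_iff, interpolationFactorZw_of_isUnramifiedAt h, div_ne_zero_iff]
  constructor
  · rintro ⟨hnum, -⟩ h1
    apply hnum
    rw [← mul_inv, h1, inv_one, sub_self]
  · intro h1
    refine ⟨?_, hden'⟩
    intro h0
    apply h1
    have : a⁻¹ * (valueAtP p χ w)⁻¹ = 1 := by linear_combination -h0
    rw [← mul_inv, inv_eq_one] at this
    exact this

/-- **Ramified branch of Definition 4**: if `χ_w` is ramified then `χ_w` is not exceptional iff the
local Gauss sum at its conductor is non-zero (the factor `(ca)^{-n}` being a unit) — and a Gauss sum of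
a character of conductor exactly `p^n` IS non-zero (Lemma A.1.1; the tree's
`gaussSum_ne_zero_of_isPrimitive`-type lemmas discharge it once `localGaussSum` is identified with the
Gauss sum of the induced primitive Dirichlet character).
[cite: Disegni2017, Def. 1.3.3 (arXiv v3 PDF p. 7 L50), Lemma A.1.1 (PDF p. 70)] -/
theorem isNotExceptionalAt_iff_of_not_isUnramifiedAt {a : ℂ} {χ : HeckeCharacter K}
    {w : HeightOneSpectrum (𝓞 K)} (h : ¬ χ.IsUnramifiedAt w) (ha : a ≠ 0) :
    IsNotExceptionalAt (p := p) a χ w ↔ localGaussSum p χ w (χ.conductorExponentAt w) ≠ 0 := by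
  rw [isNotExceptionalAt_iff, interpolationFactorZw_of_not_isUnramifiedAt h, mul_ne_zero_iff]
  have hu : ((valueAtP p χ w * a)⁻¹) ^ (χ.conductorExponentAt w) ≠ 0 :=
    pow_ne_zero _ (inv_ne_zero (mul_ne_zero (valueAtP_ne_zero χ w) ha))
  exact ⟨fun h' => h'.2, fun h' => ⟨hu, h'⟩⟩

end Factors

/-! ### §3 The cyclotomic line through `χ`: the interpolation value and the interpolation predicate -/

section Line

variable {p : ℕ} [Fact p.Prime] (ι : PadicAlgCl p ≃+* ℂ)
  (K : Type) [Field K] [NumberField K] [IsGalois ℚ K] {N : ℕ}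

/-- **Disegni's interpolation value on the line through `χ`, as an element of `ℂ_p`**, at the point
`χ' = χ · (θ∘N_{K/ℚ})` (`baseChangeDirichlet K θ`, `θ` a Dirichlet character mod `p^{m+1}`):
`ι⁻¹( Z°_p(χ'_p) · Car · L₁ )` with `Car` the archimedean constant `π²/(2L(1,η)L(1,σ,ad))` carried
as a parameter (cluster (c8)) and `L₁` standing for the continued central value
`L(1/2, σ_{E,K} ⊗ χ') = Λ(1)` (cluster (c1)). [cite: Disegni2017, Theorem A (arXiv v3 PDF p. 6 L42–44)] -/
def chiLineValue (a : ℂ) (N : ℕ) (χ : HeckeCharacter K) (𝔭 𝔭' : HeightOneSpectrum (𝓞 K))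
    {m : ℕ} (θ : DirichletCharacter ℂ (p ^ (m + 1))) (Car : ℝ) (L₁ : ℂ) : ℂ_[p] :=
  ((ι.symm (zCirc (p := p) a N (χ * baseChangeDirichlet K θ) 𝔭 𝔭' * (Car : ℂ) * L₁) :
      PadicAlgCl p) : ℂ_[p])

/-- **Theorem A of Disegni 2017 RESTRICTED TO THE CYCLOTOMIC LINE THROUGH `χ`** (characterising
predicate; nothing asserted). `G ∈ ℂ_p⟦T⟧` is a bounded line function (`IsLineFunction`) and, for every
`m` and every Dirichlet character `θ` mod `p^{m+1}` which is EVEN, of `p`-POWER ORDER, and PRIMITIVE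
unless `m = 0` (the finite-order points of `Γ_ℚ`; at `p = 2`: all even characters of `2`-power
conductor, each once), and for every ENTIRE CONTINUATION `Λ` of the Rankin–Selberg Euler product
`rankinSelbergEulerProductHecke f (χ · θ∘N) s` from `re s > 2`: the value of `G` at the point
`T = ι⁻¹(θ(γ))⁻¹ − 1` of the line (`cycLinePoint`, `γ = cyclotomicGenerator p`; `γ = 5` at `p = 2`)
is `ι⁻¹(Z°_p((χθ_K)_p) · Car · Λ(1))`. Same receptacle, same points and same θ-range as the
cluster's `CycLineInterpolation` (the line through `𝟙_K`). Parameters: `ι : ℚ̄_p ≅ ℂ`, `K`, the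
newform `f`, the unit-root datum `α ∈ ℚ_p` (UNRAMIFIED unit character), the level `N` (for `e_p`),
the character `χ`, the two places `𝔭 ≠ 𝔭′` above `p`, the archimedean constant `Car`. [cite: Disegni2017, Theorem A (arXiv v3 PDF p. 6 L31–59, p. 7 L1–6), §1.2.1 (PDF p. 5 L22–57), Lemma 10.2.1–10.2.2 (PDF p. 68)]
[cite: Disegni2023ShimuraII, §6 «Errata to [1]», Theorem A (arXiv:1907.13040, materialised p0021 L8–12)] -/
def ChiLineInterpolation (f : CuspForm (Gamma0 N) 2) (a : ℂ) (χ : HeckeCharacter K)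
    (𝔭 𝔭' : HeightOneSpectrum (𝓞 K)) (Car : ℝ) (G : PowerSeries ℂ_[p]) : Prop :=
  IsLineFunction G ∧
    ∀ (m : ℕ) (θ : DirichletCharacter ℂ (p ^ (m + 1))), θ.Even → (∃ j : ℕ, orderOf θ = p ^ j) →
      (θ.IsPrimitive ∨ m = 0) →
      ∀ Λ : ℂ → ℂ, Differentiable ℂ Λ →
        (∀ s : ℂ, 2 < s.re →
          Λ s = rankinSelbergEulerProductHecke f (χ * baseChangeDirichlet K θ) s) →
        HasLineValueAt G (cycLinePoint ι θ) (chiLineValue ι K a N χ 𝔭 𝔭' θ Car (Λ 1))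

variable {ι K}

/-- Unfolding `ChiLineInterpolation` at one character of the typed range.
[cite: Disegni2017, Theorem A (arXiv v3 PDF pp. 6–7)] -/
theorem ChiLineInterpolation.hasLineValueAt {f : CuspForm (Gamma0 N) 2} {a : ℂ}
    {χ : HeckeCharacter K} {𝔭 𝔭' : HeightOneSpectrum (𝓞 K)}
    {Car : ℝ} {G : PowerSeries ℂ_[p]} (h : ChiLineInterpolation ι K f a χ 𝔭 𝔭' Car G)
    {m : ℕ} {θ : DirichletCharacter ℂ (p ^ (m + 1))} (heven : θ.Even)
    (hord : ∃ j : ℕ, orderOf θ = p ^ j) (hprim : θ.IsPrimitive ∨ m = 0) {Λ : ℂ → ℂ}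
    (hΛ : Differentiable ℂ Λ)
    (hΛ' : ∀ s : ℂ, 2 < s.re →
      Λ s = rankinSelbergEulerProductHecke f (χ * baseChangeDirichlet K θ) s) :
    HasLineValueAt G (cycLinePoint ι θ) (chiLineValue ι K a N χ 𝔭 𝔭' θ Car (Λ 1)) :=
  h.2 m θ heven hord hprim Λ hΛ hΛ'

/-- `ChiLineInterpolation` records that `G` is a bounded line function.
[cite: Disegni2017, Lemma 10.2.1–10.2.2 (arXiv v3 PDF p. 68)] -/
theorem ChiLineInterpolation.isLineFunction {f : CuspForm (Gamma0 N) 2} {a : ℂ}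
    {χ : HeckeCharacter K} {𝔭 𝔭' : HeightOneSpectrum (𝓞 K)}
    {Car : ℝ} {G : PowerSeries ℂ_[p]} (h : ChiLineInterpolation ι K f a χ 𝔭 𝔭' Car G) :
    IsLineFunction G :=
  h.1

/-- **The base point `θ = 𝟙` of the line is `χ` itself**: the constant coefficient of `G` is
`ι⁻¹(Z°_p(χ_p) · Car · Λ(1))` for every entire continuation `Λ` of
`rankinSelbergEulerProductHecke f χ` — Theorem A AT `χ` (`𝟙 ∘ N = 𝟙_K`, `baseChangeDirichlet_one`;
in the situation of Theorem B, `ε(A_E, χ) = −1`, this value is `0`, consumer-side).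
[cite: Disegni2017, Theorem A (arXiv v3 PDF p. 6 L42–44)] -/
theorem ChiLineInterpolation.constantCoeff_eq {f : CuspForm (Gamma0 N) 2} {a : ℂ}
    {χ : HeckeCharacter K} {𝔭 𝔭' : HeightOneSpectrum (𝓞 K)}
    {Car : ℝ} {G : PowerSeries ℂ_[p]} (h : ChiLineInterpolation ι K f a χ 𝔭 𝔭' Car G)
    {Λ : ℂ → ℂ} (hΛ : Differentiable ℂ Λ)
    (hΛ' : ∀ s : ℂ, 2 < s.re → Λ s = rankinSelbergEulerProductHecke f χ s) :
    PowerSeries.constantCoeff G =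
      chiLineValue ι K a N χ 𝔭 𝔭' (1 : DirichletCharacter ℂ (p ^ (0 + 1))) Car (Λ 1) := by
  have heven : (1 : DirichletCharacter ℂ (p ^ (0 + 1))).Even :=
    MulChar.one_apply isUnit_one.neg
  have hΛ'' : ∀ s : ℂ, 2 < s.re → Λ s = rankinSelbergEulerProductHecke f
      (χ * baseChangeDirichlet K (1 : DirichletCharacter ℂ (p ^ (0 + 1)))) s := by
    intro s hs
    rw [baseChangeDirichlet_one, mul_one]
    exact hΛ' s hs
  have hv := h.2 0 1 heven ⟨0, by rw [orderOf_one, pow_zero]⟩ (Or.inr rfl) Λ hΛ hΛ''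
  rw [cycLinePoint_one] at hv
  exact (hv.eq_constantCoeff).symm

/-- At the base point the twisting character is trivial: `chiLineValue` at `θ = 𝟙` is
`ι⁻¹(Z°_p(χ_p) · Car · L₁)`. [cite: Disegni2017, Theorem A (arXiv v3 PDF p. 6 L42–44)] -/
theorem chiLineValue_one (a : ℂ) (N : ℕ) (χ : HeckeCharacter K)
    (𝔭 𝔭' : HeightOneSpectrum (𝓞 K)) (m : ℕ) (Car : ℝ) (L₁ : ℂ) :
    chiLineValue ι K a N χ 𝔭 𝔭' (1 : DirichletCharacter ℂ (p ^ (m + 1))) Car L₁ =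
      ((ι.symm (zCirc (p := p) a N χ 𝔭 𝔭' * (Car : ℂ) * L₁) : PadicAlgCl p) : ℂ_[p]) := by
  rw [chiLineValue, baseChangeDirichlet_one, mul_one]

end Line

/-! ### §4 Theorem A (Disegni 2017) on the line through `χ` — the named fact -/

section TheoremA

/-- **Disegni 2017, Theorem A, restricted to the cyclotomic lines through the finite-order characters
`χ ∈ 𝒴′^{l.c.}` of an imaginary quadratic `K` in which `p` SPLITS, for a weight-`2` newform of
trivial character which is `𝔭`-ORDINARY at `p` with an UNRAMIFIED unit character — ANY prime `p`,
`p = 2` INCLUDED** (named fact, `def … : Prop`, nothing proved; module docstring §«What is typed»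
for every specialisation (S1)–(S5) and evaluation (E1)–(E4)). Hypotheses: `K` imaginary quadratic
(Galois over `ℚ`), `p𝒪_K = 𝔭𝔭′` split (`E_v/F_v` split; the two places are the explicit parameters
`𝔭 ≠ 𝔭′`); `f ∈ S₂(Γ₀(N))` a newform (`IsNewform0`; `σ = σ_f`, `ω = 𝟙`; for an elliptic curve
`E/ℚ`: `f` THE newform of `E`, `N = N_E`, `IsNewformOf`); `σ_p` nearly `𝔭`-ordinary with UNRAMIFIED
unit character [Def. 1.2.2]: `p² ∤ N` and `a ∈ ℂ` a root of the Hecke polynomial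
`X² − a_p(f)X + p·𝟙_{p∤N}` whose transport `ι⁻¹(a) ∈ ℚ̄_p` is a `p`-adic UNIT (`a = ι(α)`,
`α = α_p(p)`; for `E/ℚ` good ordinary at `p`: `α = unitRoot E p`; multiplicative: `a = a_p = ±1`).
Conclusion: there is ONE archimedean constant `Car > 0` (print: `π²/(2L(1,η)L(1,σ,ad))`, independent
of the character) such that for every finite-order `χ` with `χ|_{Ẑ^{(p),×}} = 1` — VERBATIM the
condition `ω·χ′|_{Ô_F^{p,×}} = 1` defining `𝒴′^{l.c.}` for `ω = 𝟙` [§1.2.1] — and [TREE-CURRENCY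
binder (S5), not Disegni's] unramified above every prime `ℓ` with `ℓ² ∣ N` (= «at every place where
both `σ` and `χ` ramify, `σ` is Steinberg»; then the tree's `rankinSelbergEulerProductHecke f (χθ_K)`
IS the automorphic `L(s − 1/2, σ_K ⊗ χθ_K)` at every point of the line), there is a bounded line
function `G` with `ChiLineInterpolation ι K f a χ 𝔭 𝔭′ Car G`. ROAD (C) of the cell (the pair
`(A, χ₀·χ₂·ε_{d′}∘N)`, `A` CM by `ℚ(√−7)`, `p = 2` split): move every genus factor `ε∘N` of the
character into the form (`σ_{A,K} ⊗ (ε∘N·χ′) = σ_{A⊗ε,K} ⊗ χ′`); the binder then asks nothing above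
`2` when the form is good ordinary at `2`, and asks `χ′ = χ₀χ₂` UNRAMIFIED above the additive primes
of the form (for `7² ∣ N`: `χ₀` unramified above `(√−7)`) — inside the typed range iff so.
`-- TODO(general form)`: `F` totally real, `p` inert/ramified in `E` (the other cases of `Z_w`),
RAMIFIED unit characters `α_v` (defect-`e` twists; the addord `𝟙_K`-line is recovered here only in
its `(V, ε_K)` frame), `M`-rational `σ` read at a prime `𝔭 ∤ ι` of `M`, and characters `χ` jointly
ramified with an additive prime of `σ` (needs the automorphic local factors the tree's Euler product
drops). [cite: Disegni2017, Theorem A (arXiv v3 PDF p. 6 L31–59, p. 7 L1–14), Def. 1.2.2 (PDF p. 5 L8–18), §1.2.1 (PDF p. 5 L22–57)]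
[cite: Disegni2023ShimuraII, §6 «Errata to [1]», Theorem A (arXiv:1907.13040, materialised p0021 L8–12)] -/
def thmA_chiLine : Prop :=
  ∀ {p : ℕ} [Fact p.Prime] (ι : PadicAlgCl p ≃+* ℂ) (K : Type) [Field K] [NumberField K]
    [IsGalois ℚ K] (𝔭 𝔭' : HeightOneSpectrum (𝓞 K)) {N : ℕ} [NeZero N]
    (f : CuspForm (Gamma0 N) 2) (a : ℂ),
    IsImaginaryQuadratic K → ((Ideal.span {(p : ℤ)}).primesOver (𝓞 K)).ncard = 2 →
    ((p : ℕ) : 𝓞 K) ∈ 𝔭.asIdeal → ((p : ℕ) : 𝓞 K) ∈ 𝔭'.asIdeal → 𝔭 ≠ 𝔭' →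
    IsNewform0 f → ¬ p ^ 2 ∣ N →
    a ^ 2 - cuspCoeff f p * a + (if p ∣ N then (0 : ℂ) else (p : ℂ)) = 0 →
    ‖(ι.symm a : PadicAlgCl p)‖ = 1 →
    ∃ Car : ℝ, 0 < Car ∧
      ∀ χ : HeckeCharacter K, χ.IsFiniteOrder →
        (∀ (v : HeightOneSpectrum (𝓞 ℚ)) (u : (v.adicCompletionIntegers ℚ)ˣ),
            ((p : ℕ) : 𝓞 ℚ) ∉ v.asIdeal →
            χ (AdeleRing.ideleBaseChange ℚ K
              (localUnits v (Units.map ((v.adicCompletionIntegers ℚ).subtype : _ →* _) u))) = 1) →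
        (∀ (w : HeightOneSpectrum (𝓞 K)) (ℓ : ℕ), ℓ.Prime → ((ℓ : ℕ) : 𝓞 K) ∈ w.asIdeal →
            ℓ ^ 2 ∣ N → χ.IsUnramifiedAt w) →
        ∃ G : PowerSeries ℂ_[p], ChiLineInterpolation ι K f a χ 𝔭 𝔭' Car G

/-- **The elliptic-curve reading of the unit-root binders of `thmA_chiLine`** (the form in which an
`E/ℚ`-consumer meets them): for `f` the newform of `E` (`IsNewformOf W f`, so `a_p(f) = a_p(E)`),
GOOD ORDINARY at `p` with `α = unitRoot W p ∈ ℤ_p^×` a root of `X² − a_pX + p`, the complex number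
`a := ι(α)` satisfies the Hecke-polynomial clause with `e_p = p` and `‖ι⁻¹a‖ = ‖α‖ = 1`. Stated as
the implication it is (hypotheses: the printed level/coefficient facts as binders), PROVED by
transport of structure along `ι`. [cite: Disegni2017, Def. 1.2.2 (arXiv v3 PDF p. 5 L8–12)] -/
theorem heckePolynomial_clause_of_unitRoot {p : ℕ} [Fact p.Prime] (ι : PadicAlgCl p ≃+* ℂ)
    {N : ℕ} (f : CuspForm (Gamma0 N) 2) (W : WeierstrassCurve ℚ) [W.IsGloballyMinimal]
    (hpN : ¬ p ∣ N) (hf : cuspCoeff f p = (W.frobeniusTrace p : ℂ)) (α : ℤ_[p])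
    (hα : α ^ 2 - (W.frobeniusTrace p : ℤ_[p]) * α + p = 0) (hu : IsUnit α) :
    (ι ((α : ℚ_[p]) : PadicAlgCl p)) ^ 2 - cuspCoeff f p * ι ((α : ℚ_[p]) : PadicAlgCl p) +
        (if p ∣ N then (0 : ℂ) else (p : ℂ)) = 0 ∧
      ‖(ι.symm (ι ((α : ℚ_[p]) : PadicAlgCl p)) : PadicAlgCl p)‖ = 1 := by
  constructor
  · rw [if_neg hpN, hf]
    let φ : ℤ_[p] →+* ℂ :=
      ι.toRingHom.comp ((algebraMap ℚ_[p] (PadicAlgCl p)).comp PadicInt.Coe.ringHom)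
    have hφ : φ α = ι ((α : ℚ_[p]) : PadicAlgCl p) := rfl
    have h := congrArg φ hα
    rw [map_add, map_sub, map_pow, map_mul, map_intCast, map_natCast, map_zero, hφ] at h
    exact h
  · rw [RingEquiv.symm_apply_apply, PadicAlgCl.norm_extends, ← PadicInt.norm_def]
    exact PadicInt.isUnit_iff.mp hu

end TheoremA


/-! ### §5 (append, g49) The ramified branch as a Mathlib Gauss sum — bridge for the Definition-4 discharge -/

section DirichletModel

variable {p : ℕ} [Fact p.Prime] {K : Type} [Field K] [NumberField K]

/-- **The local Gauss sum IS the Gauss sum of the modelling Dirichlet character** (level `p^n`,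
`n ≥ 1`, standard additive character): if a Dirichlet character `ξ` mod `p^n` MODELS `χ_w` on the
units — `χ_w(k) = ξ(k mod p^n)` for every natural `k` prime to `p`, i.e. `ξ` is the character induced
by `χ_w` on `(𝒪_{E_w}/𝔣)^× = (ℤ/p^n)^×`, `E_w = ℚ_p` — then `localGaussSum χ w n = gaussSum ξ stdAddChar`
(the terms at `p ∣ k` vanish on both sides, `k` being a non-unit of `ℤ/p^n`). With `n = f(χ_w)` (so
`ξ` primitive of conductor `p^n`) this turns the ramified branch of Definition 4
(`isNotExceptionalAt_iff_of_not_isUnramifiedAt`) into «`gaussSum ξ stdAddChar ≠ 0`» — Lemma A.1.1, in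
the tree as `DirichletCharacter.IsPrimitive.gaussSum_stdAddChar_ne_zero` /
`GaussSums.gaussSum_ne_zero_of_conductor` (cell seat -w8, `PadicUnitCharacterPrimitiveGaussSum.lean`).
[cite: Disegni2017, Theorem A, τ(χ̃'_w, ψ_{E_w}) (arXiv v3 PDF p. 7 L2–6); Lemma A.1.1 (PDF p. 70)] -/
theorem localGaussSum_eq_gaussSum {χ : HeckeCharacter K} {w : HeightOneSpectrum (𝓞 K)} {n : ℕ}
    (hn : 0 < n) [NeZero (p ^ n)] {ξ : DirichletCharacter ℂ (p ^ n)}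
    (h : ∀ k : ℕ, ¬ p ∣ k → localValueNat χ w k = ξ (k : ZMod (p ^ n))) :
    localGaussSum p χ w n = gaussSum ξ (ZMod.stdAddChar (N := p ^ n)) := by
  have hp : p.Prime := Fact.out
  rw [localGaussSum, gaussSum]
  symm
  refine Finset.sum_nbij' (fun a : ZMod (p ^ n) => a.val) (fun k : ℕ => (k : ZMod (p ^ n)))
    (fun a _ => Finset.mem_range.mpr (ZMod.val_lt a)) (fun _ _ => Finset.mem_univ _)
    (fun a _ => ZMod.natCast_zmod_val a)
    (fun k hk => by rw [ZMod.val_natCast, Nat.mod_eq_of_lt (Finset.mem_range.mp hk)])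
    (fun a _ => ?_)
  rw [ZMod.natCast_zmod_val]
  by_cases hk : p ∣ a.val
  · have hna : ¬ IsUnit a := by
      intro hu
      have hcop : (a.val).Coprime (p ^ n) :=
        (ZMod.isUnit_iff_coprime a.val (p ^ n)).mp (by rwa [ZMod.natCast_zmod_val])
      exact hp.one_lt.ne' ((Nat.Coprime.coprime_dvd_left hk hcop).eq_one_of_dvd (dvd_pow_self p hn.ne'))
    rw [if_pos hk, ξ.map_nonunit hna]
  · rw [if_neg hk, h a.val hk, ZMod.natCast_zmod_val]

/-- **Definition 4, ramified branch, through the modelling Dirichlet character**: if `χ_w` is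
ramified, `a ≠ 0`, and `ξ` mod `p^{f(χ_w)}` models `χ_w` on the units, then `χ_w` is not exceptional iff
`gaussSum ξ stdAddChar ≠ 0`. [cite: Disegni2017, Def. 1.3.3 (arXiv v3 PDF p. 7 L50); Lemma A.1.1 (PDF p. 70)] -/
theorem isNotExceptionalAt_iff_gaussSum_ne_zero {a : ℂ} {χ : HeckeCharacter K}
    {w : HeightOneSpectrum (𝓞 K)} (hram : ¬ χ.IsUnramifiedAt w) (ha : a ≠ 0)
    (hn : 0 < χ.conductorExponentAt w) [NeZero (p ^ χ.conductorExponentAt w)]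
    {ξ : DirichletCharacter ℂ (p ^ χ.conductorExponentAt w)}
    (h : ∀ k : ℕ, ¬ p ∣ k → localValueNat χ w k = ξ (k : ZMod (p ^ χ.conductorExponentAt w))) :
    IsNotExceptionalAt (p := p) a χ w ↔
      gaussSum ξ (ZMod.stdAddChar (N := p ^ χ.conductorExponentAt w)) ≠ 0 := by
  rw [isNotExceptionalAt_iff_of_not_isUnramifiedAt hram ha, localGaussSum_eq_gaussSum hn h]

end DirichletModel

end Literature.NumberTheory.EllipticCurves.Disegni2017

end
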